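import Summits.QuantumFields.GaugeBoot.DiagonalRPTorusOddStaircaseIntegral
import Summits.QuantumFields.GaugeBoot.WilsonWeightNegativeBeta
import Summits.QuantumFields.GaugeBoot.TiltedBoxOddAxisGaugeGroups
import HarnessLib

/-!
# On ODD two-tori at `β < 0` diagonal reflection positivity fails EVEN FOR GAUGE-INVARIANT
observables (gauge-boot, L3(θ) gauge-invariant sector at `β < 0`, 3/3)

HONEST FRAMING (cell `pub-gaugeboot`, page 1 of every file): the venture produces certified bounds
on lattice expectations at stated coupling, gauge group, dimension and torus size; NOT a mass gap,
NOT a continuum limit, NOT a string tension; NOT Yang–Mills-summit-bearing (barriers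
`FixedCouplingUltralocality`, `PerturbativeInvisibility`). A small NEGATIVE structural result about
which positivity constraints a two-dimensional TORUS certificate may use; no two-dimensional
certificate with a diagonal block exists or is planned; nothing at `β ≥ 0` changes.

## Content

The tree's `d = 2` torus table (`DiagonalRPTorusTwoAllBeta`: on `(ℤ/L)²`, `L ≥ 3`, closed-half
diagonal RP `↔ (Odd L ∧ 0 ≤ β) ∨ β = 0`) left OPEN whether, on ODD tori at `β < 0`, the failure is
a gauge artefact — the known witnesses (cut-plaquette transports) are gauge-VARIANT, while the
gauge-invariant sector HOLDS on even tori at `β ≥ 0` (`DiagonalRPTorusGaugeInvariantTwo`) and on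
odd tori at `β ≥ 0` (`gaugeInvariantDiagonalRP_two_odd`). It is not an artefact:

* ★★ **`wilsonExpectation_stairWitness_eq`** — `L ≥ 5` odd, `ρ` continuous, `N ≥ 1`,
  `wAvg ρ w_β = c • 1`: for the GAUGE-INVARIANT closed-half observable
  `F = tr ρ(staircase loop along the mirror) · e^{-β S_int}` (`stairWitness`),
  `⟨(ΘF)‾ F⟩_{Λ,β} = K · c^L · P` with `K, P > 0` (`rpIntegrand_eq_odd` +
  `integral_rpPhiOdd_stairWitness_eq`: the `L` mirror plaquettes are integrated one at a time,
  each producing the scalar `c` of the one-link Wilson weight).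
* ★★★ **`not_gaugeInvariantDiagonalRP_odd_of_neg`** — `G` compact metrisable, `ρ` continuous with
  scalar commutant and `ρ ≢ 1` (`SU(N)`, `U(N)`, `U(1)`, …), `(ℤ/L)²` with `L ≥ 5` ODD, `i ≠ j`,
  `β < 0`: `¬ GaugeInvariantDiagonalRP ρ β i j` (`c = c_β < 0`, tree
  `TwistedSlab.wAvg_wilsonWeight_eq_smul_neg`, and `L` odd make `c^L < 0`).
* ★★★ **`gaugeInvariantDiagonalRP_odd_iff`** — hence on odd tori `L ≥ 5`:
  `GaugeInvariantDiagonalRP ρ β i j ↔ 0 ≤ β` (the positive side is the tree's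
  `DiagRPTwo.gaugeInvariantDiagonalRP_two_odd`); `_suN` (`N ≥ 2`), `_uN` (`N ≥ 1`).

So the gen-61 table holds verbatim in the gauge-invariant sector on odd tori: the negative-coupling
failure is carried by a Wilson LOOP (the non-contractible staircase hugging the mirror), not only by
open transports. NOT treated: `L = 3` (the far layer touches the mirror plaquettes; the proof needs
`L ≥ 5`), even `L` at `β < 0` (gauge-invariant sector; open), `d ≥ 3`. Not in print as far as the
cell's searches go. Elementary.
-/

open MeasureTheory Complex Finset Function
open scoped ComplexOrder ENNReal

namespace Summit.QuantumFields.GaugeBoot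

open Literature.MathematicalPhysics.QuantumFieldTheory
open Literature.MathematicalPhysics.QuantumLattice (fundamentalRep unitaryFundamentalRep
  continuous_fundamentalRep continuous_unitaryFundamentalRep)
open Literature.RepresentationTheory.CompactGroups

noncomputable section

namespace DiagRPTwo

section Main

variable {L N : ℕ} [NeZero L] {G : Type*} [Group G] [TopologicalSpace G] [IsTopologicalGroup G]
  [CompactSpace G] [MeasurableSpace G] [BorelSpace G] [SecondCountableTopology G]
  (ρ : G →* Matrix (Fin N) (Fin N) ℂ) {i j : Fin 2}

/-- ★★ **The RP expectation of the staircase witness**: `L ≥ 5` odd, `i ≠ j`, `ρ` continuous with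
`N ≥ 1` and `wAvg ρ w_β = c • 1`. Then `⟨(ΘF)‾ F⟩_{Λ,β} = K · (c^L · P)` with `K, P > 0` real. -/
theorem wilsonExpectation_stairWitness_eq (hL : Odd L) (h5 : 5 ≤ L) (hij : i ≠ j) (hρ : Continuous ρ)
    (hN : 1 ≤ N) {β : ℝ} {c : ℝ}
    (hc : TwistedSlab.wAvg ρ (TwistedSlab.wilsonWeight ρ β) = ((c : ℂ)) • (1 : Matrix (Fin N) (Fin N) ℂ)) :
    ∃ K P : ℝ, 0 < K ∧ 0 < P ∧
      wilsonExpectation (d := 2) (L := L) ρ β (fun U : GaugeConfig 2 L G =>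
        (starRingEnd ℂ) (stairWitness ρ i j β (configDiagSwap i j U)) * stairWitness ρ i j β U) =
        ((K * (c ^ L * P) : ℝ) : ℂ) := by
  have h3 : 3 ≤ L := by omega
  obtain ⟨P, hP, hI⟩ := integral_rpPhiOdd_stairWitness_eq (L := L) (i := i) (j := j) ρ h5 hij hρ hN hc
  obtain ⟨hZ0, hZT⟩ := partitionFunction_ne_zero_ne_top (d := 2) (L := L) ρ hρ β
  set F := stairWitness (L := L) ρ i j β with hF
  have hdens : Measurable fun U : GaugeConfig 2 L G =>
      ENNReal.ofReal (Real.exp (-β * wilsonAction ρ U)) :=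
    ENNReal.measurable_ofReal.comp ((WilsonRP.measurable_wilsonAction ρ hρ).const_mul (-β)).exp
  refine ⟨((partitionFunction (d := 2) (L := L) ρ β)⁻¹).toReal *
      Real.exp (-(β * (N * Fintype.card (Plaquette 2 L)))), P,
    mul_pos (ENNReal.toReal_pos (ENNReal.inv_ne_zero.2 hZT) (ENNReal.inv_ne_top.2 hZ0))
      (Real.exp_pos _), hP, ?_⟩
  unfold wilsonExpectation wilsonMeasure
  rw [integral_smul_measure]
  unfold wilsonWeight
  rw [integral_withDensity_eq_integral_toReal_smul hdens (ae_of_all _ fun _ => ENNReal.ofReal_lt_top)]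
  simp_rw [ENNReal.toReal_ofReal (Real.exp_nonneg _), Complex.real_smul]
  simp_rw [rpIntegrand_eq_odd ρ hL h3 hij hρ β F]
  rw [integral_const_mul]
  change _ * (_ * ∫ U, rpPhiOdd ρ i j β F U ∂(linkMeasure L G)) = _
  rw [hI]
  push_cast
  ring

/-- ★★★ **ON ODD TWO-TORI AT `β < 0`, DIAGONAL RP FAILS IN THE GAUGE-INVARIANT SECTOR.** `G` compact
metrisable, `ρ : G → M_N(ℂ)` continuous with scalar commutant and `ρ ≢ 1`, `(ℤ/L)²` with `L ≥ 5`
odd, `i ≠ j`, `β < 0`: the gauge-invariant closed-half observable `stairWitness` has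
`⟨(ΘF)‾ F⟩_{Λ,β} < 0`, so `¬ GaugeInvariantDiagonalRP ρ β i j`. -/
theorem not_gaugeInvariantDiagonalRP_odd_of_neg (hL : Odd L) (h5 : 5 ≤ L) (hij : i ≠ j)
    (hρ : Continuous ρ) (hirr : TwistedSlab.HasScalarCommutant ρ) (hρ1 : ∃ g, ρ g ≠ 1) {β : ℝ}
    (hβ : β < 0) : ¬ GaugeInvariantDiagonalRP (d := 2) (L := L) ρ β i j := by
  have hN : 1 ≤ N := by
    rcases Nat.eq_zero_or_pos N with h0 | h0
    · exfalso
      obtain ⟨g, hg⟩ := hρ1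
      subst h0
      exact hg (Subsingleton.elim _ _)
    · exact h0
  obtain ⟨c, hcneg, hc⟩ := TwistedSlab.wAvg_wilsonWeight_eq_smul_neg ρ hirr hρ hρ1 hβ hN
  obtain ⟨K, P, hK, hP, hE⟩ :=
    wilsonExpectation_stairWitness_eq (L := L) (i := i) (j := j) ρ hL h5 hij hρ hN hc
  intro hRP
  have h := hRP (stairWitness ρ i j β) (measurable_stairWitness ρ hρ β)
    (exists_norm_stairWitness_le ρ hρ β) (isDiagonalHalfObservable_stairWitness ρ (by omega) hij β)
    (isGaugeInvariant_stairWitness ρ hij β)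
  rw [hE] at h
  have hneg : K * (c ^ L * P) < 0 :=
    mul_neg_of_pos_of_neg hK (mul_neg_of_neg_of_pos (Odd.pow_neg hL hcneg) hP)
  exact absurd (Complex.zero_le_real.1 h) (not_le.2 hneg)

/-- ★★★ **The gauge-invariant diagonal RP on odd two-tori, all real `β`**: `L ≥ 5` odd, `ρ`
continuous with scalar commutant and `ρ ≢ 1`: `GaugeInvariantDiagonalRP ρ β i j ↔ 0 ≤ β`
(positive side: the tree's `gaugeInvariantDiagonalRP_two_odd`, valid for all observables). -/
theorem gaugeInvariantDiagonalRP_odd_iff (hL : Odd L) (h5 : 5 ≤ L) (hij : i ≠ j) (hρ : Continuous ρ)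
    (hirr : TwistedSlab.HasScalarCommutant ρ) (hρ1 : ∃ g, ρ g ≠ 1) (β : ℝ) :
    GaugeInvariantDiagonalRP (d := 2) (L := L) ρ β i j ↔ 0 ≤ β := by
  constructor
  · intro h
    by_contra hβ
    exact not_gaugeInvariantDiagonalRP_odd_of_neg ρ hL h5 hij hρ hirr hρ1 (not_le.1 hβ) h
  · exact fun hβ => gaugeInvariantDiagonalRP_two_odd ρ hL (by omega) hρ hβ hij

end Main

/-! ## The venture's gauge groups -/

section Groups

/-- ★★★ **`SU(N)`, `N ≥ 2`, on `(ℤ/L)²` with `L ≥ 5` odd**: the gauge-invariant closed-half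
diagonal RP holds IFF `0 ≤ β`. -/
theorem gaugeInvariantDiagonalRP_odd_iff_suN {L N : ℕ} [NeZero L] (hL : Odd L) (h5 : 5 ≤ L)
    (hN : 2 ≤ N) {i j : Fin 2} (hij : i ≠ j) (β : ℝ) :
    GaugeInvariantDiagonalRP (d := 2) (L := L) (fundamentalRep (Fin N)) β i j ↔ 0 ≤ β := by
  haveI : SecondCountableTopology (Matrix (Fin N) (Fin N) ℂ) :=
    inferInstanceAs (SecondCountableTopology (Fin N → Fin N → ℂ))
  haveI : SecondCountableTopology (Matrix.specialUnitaryGroup (Fin N) ℂ) :=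
    Topology.IsEmbedding.subtypeVal.secondCountableTopology
  exact gaugeInvariantDiagonalRP_odd_iff (fundamentalRep (Fin N)) hL h5 hij
    (continuous_fundamentalRep (Fin N)) TiltedRP.hasScalarCommutant_fundamentalRep
    (TiltedRP.exists_fundamentalRep_ne_one hN) β

/-- ★★★ **`U(N)`, `N ≥ 1` (so `U(1)` too), on `(ℤ/L)²` with `L ≥ 5` odd**: the gauge-invariant
closed-half diagonal RP holds IFF `0 ≤ β`. -/
theorem gaugeInvariantDiagonalRP_odd_iff_uN {L N : ℕ} [NeZero L] (hL : Odd L) (h5 : 5 ≤ L)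
    (hN : 1 ≤ N) {i j : Fin 2} (hij : i ≠ j) (β : ℝ) :
    GaugeInvariantDiagonalRP (d := 2) (L := L) (unitaryFundamentalRep (Fin N) ℂ) β i j ↔ 0 ≤ β := by
  haveI : SecondCountableTopology (Matrix (Fin N) (Fin N) ℂ) :=
    inferInstanceAs (SecondCountableTopology (Fin N → Fin N → ℂ))
  haveI : SecondCountableTopology (Matrix.unitaryGroup (Fin N) ℂ) :=
    Topology.IsEmbedding.subtypeVal.secondCountableTopology
  exact gaugeInvariantDiagonalRP_odd_iff (unitaryFundamentalRep (Fin N) ℂ) hL h5 hij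
    (continuous_unitaryFundamentalRep (n := Fin N) (𝕜 := ℂ)) TiltedRP.hasScalarCommutant_unitaryFundamentalRep
    (TiltedRP.exists_unitaryFundamentalRep_ne_one hN) β

end Groups

end DiagRPTwo

end

end Summit.QuantumFields.GaugeBoot
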